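/-
Copyright: public-domain mathematics; typed transcription for the H21 Literature library (cell lit-balaban,
reader/typer seat r02 gen 5 = literature-prover-lit-balaban-r02-g5-0).

statement-level skeleton of published theorems with citation tags; proofs where landed; nothing here is a claim about the Yang–Mills mass gap

# Bałaban, *Propagators and renormalization transformations for lattice gauge theories. I*,
# Commun. Math. Phys. **95** (1984) 17–40 — the UNIT-SCALE COVER behind p. 36 «imply immediately» ((1.110)–(1.114) ⇒
# (1.115)–(1.117)) for the setting of record: the printed partition profile of (1.118) at scale 1 and plateau cut-offs in the
# doubled cubes `Δ̃(y)`, on the torus `T_η` of `latticeSettingP12 n M a k`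

[cite: Balaban1984PropagatorsI]  T. Bałaban, Commun. Math. Phys. 95 (1984) 17–40.  p. 36 (PDF p. 20), verbatim (OCR layer of the
held scan `paper:balaban1984-cmp95-propagators-rt-i` p0020.txt, checked against the b2b render p020): «The localized inequalities
(1.110)–(1.114) imply immediately the following global inequalities |GJ|, |∇GJ|, |G∇*J|, |ΔGJ|, ‖∇GJ‖_α, ‖G∇*J‖_α ≤ O(1)|J|,
(1.115) … with the same dependence of the constants O(1).»; p. 35: «Cubes Δ̃(y) are sums of 2^d unit cubes having the point
y as a corner, thus they are cubes of size 2 and with a center at y.»; (1.118) p. 36: «h ∈ C₀^∞(]−⅔, ⅔[)», «h(t) = 1 for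
t ∈ [−⅓, ⅓]», «Σ_n h²(t − n) = 1, hence Σ_z h_z²(x) = 1».

WHAT THIS MODULE ADDS (SKELETON rows B5.Eq1.117 / B5.Prop1.2, owner's census; file A of the located leaves G-B5-26 =
`B5Global115.GlobCover` FOR THE SETTING OF RECORD `B5Prop12FieldsLattice.latticeSettingP12 n M a k`).  The word «immediately» of
p. 36 hides a decomposition `J = Σ_{y′∈T₁} ζ′_{y′}J` with `supp ζ′_{y′}J ⊂ Δ̃(y′)` and cut-offs `ζ_y ∈ C₀^∞(Δ̃(y))`; the tree's
`B5Global115.global_inst`/`global_of_prop12` take them as the located leaves `GlobCover` (pieces, cut-offs, their (1.108)/(1.109)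
sizes).  Here, on the fine torus `T_η = Tor (fine n M)` (`η = 1/n`) with unit lattice `T₁ = Tor M`, we CONSTRUCT and ESTIMATE:
* §1 a generic circular-Lipschitz lemma for periodised compactly supported profiles (`per_lipschitz`: window ⅛, vanishing
  radius ⅞, tori with `≥ 2` unit cubes per direction) and `|Πa − Πb| ≤ Σ|a − b|` on `[0,1]` (`abs_prod_sub_prod_le`);
* §2 unit coordinates `uc x μ = x_μ/n` and the dictionary `n·|crep_{M_μ}(x_μ/n − x′_μ/n)| = cdistF x x′ μ ≤ n·distU x x′`
  (`cdistF_eq_mul_abs_crep`, `abs_crep_uc_sub_le_distU`), `x ∈ Δ̃(y) ↔ ∀ μ |crep_{M_μ}(x_μ/n − y_μ)| ≤ 1` (`mem_cubeT_iff_crep`);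
* §3 the PIECE WEIGHTS `wP y′ x = h_{y′}(x)²` with THE PRINTED PROFILE `h` of (1.118) at scale `M₀ := 1` unit (`= n` fine steps;
  `B5Partition118Printed.hzR`): `Σ_{y′∈T₁} wP y′ x = 1` EXACTLY (`sum_wP`), `0 ≤ wP ≤ 1`, `wP y′ x ≠ 0 ⇒ x ∈ Δ̃(y′)`
  (`mem_cubeT_of_wP_ne_zero`), and the unit-scale Lipschitz bound `|wP y′ x − wP y′ x′| ≤ Lw(d)·|x − x′|` UNIFORM in `η`
  and in the torus (`abs_wP_sub_le`, `Lw d = 2d·max(sup|h′|, 8)`);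
* §4 the PLATEAU CUT-OFFS `cutP y x = Π_μ θ(crep_{M_μ}(x_μ/n − y_μ))` with r01's C^∞ plateau profile `θ = B4PartitionUnity22.thetaProf`
  (`= 1` on `|t| ≤ ¾`, `= 0` for `|t| ≥ ⅞`): `supp cutP y ⊂ Δ̃(y)` (`cutInL_cutP`), `0 ≤ cutP ≤ 1`, `cutP y = 1` on
  `{|crep(x_μ/n − y_μ)| ≤ ¾ ∀μ}` (`cutP_eq_one_of`), Lipschitz `|cutP y x − cutP y x′| ≤ Lθ(d)·|x − x′|` (`abs_cutP_sub_le`);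
* §5 the NEAREST UNIT-LATTICE POINT `nearOf x` (`|crep(x_μ/n − nearOf_μ)| ≤ ½`), `x ∈ Δ̃(nearOf x)` (`mem_cubeT_nearOf`), and the
  PLATEAU LEMMA: `|x − x′| ≤ ¼ ⇒ cutP (nearOf x) x = cutP (nearOf x) x′ = 1` (`cutP_nearOf_eq_one`, `cutP_nearOf_eq_one_of_distU_le`)
  — the fact behind the (unprinted, ours) local-to-global step `‖f‖_α ≤ O(1)(sup_y ‖ζ_yf‖_α + |f|)` that «immediately» hides.
(v1.1, QUOTE-AUDIT-B5 item B6 + sweep: guillemets in this file = verbatim print only; two cite tags re-pointed from the p. 36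
sentence about the M₀-cubes □_z to the p. 35 sentence about Δ̃(y); declarations byte-identical.)
File B (`GlobCover` record + `global_of_prop12` for the setting of record) consumes exactly these.

HONEST SCOPE.  (i) Tori with at least two unit cubes in every direction (`2 ≤ M μ`) where the partition sums to one (Bałaban's
tori are large).  (ii) The partition is the (1.118) profile `h²` at scale one (the paper leaves the unit-scale decomposition
implicit in «immediately»); the cut-off profile `θ` is r01's, not printed.  (iii) Constants ours.  Pure lattice geometry: no
operator of the paper enters; nothing of B5 is used as a hypothesis.
-/
import Mathlib
import Literature.MathematicalPhysics.QuantumFieldTheory.Balaban1983to89.B5RowSumsP12Lattice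
import Literature.MathematicalPhysics.QuantumFieldTheory.Balaban1983to89.B5Partition118Printed

open scoped BigOperators Real
open Finset

namespace Literature.MathematicalPhysics.QuantumFieldTheory.Balaban1983to89.B5CoverP12Lattice

open Literature.MathematicalPhysics.QuantumFieldTheory.Balaban1983to89
open Literature.MathematicalPhysics.QuantumFieldTheory.Balaban1983to89.B5Prop11Plancherel (Tor fine)
open Literature.MathematicalPhysics.QuantumFieldTheory.Balaban1983to89.B5Prop12FieldsLattice
open Literature.MathematicalPhysics.QuantumFieldTheory.Balaban1983to89.B4TorusKernel.MultiPeriod (circAbs circAbs_nonneg)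
open Literature.MathematicalPhysics.QuantumFieldTheory.Balaban1983to89.B4Sect5Torus (TSite)
open Literature.MathematicalPhysics.QuantumFieldTheory.Balaban1983to89.B6Cov2156Torus (one_le_M)
open Literature.MathematicalPhysics.QuantumFieldTheory.Balaban1983to89.B4PartitionUnity22 (hprof hprof_nonneg hprof_le_one
  hprof_eq_zero thetaProf thetaProf_nonneg thetaProf_le_one thetaProf_eq_one thetaProf_eq_zero contDiff_hprof
  hasCompactSupport_hprof contDiff_thetaProf hasCompactSupport_thetaProf D1 D1_nonneg abs_sub_le_D1)
open Literature.MathematicalPhysics.QuantumFieldTheory.Balaban1983to89.B5Partition118Printed (crep abs_crep_le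
  abs_crep_le_abs_sub crep_eq_sub crep_add_int_mul hper hper_eq_zero hzR hzR_nonneg hzR_le_one sum_hzR_sq
  natMul_abs_crep_eq_circAbs)
open Literature.MathematicalPhysics.QuantumFieldTheory.Balaban1983to89.B5RowSumsP12Lattice (chartSite chartSite_injective
  chartSite_apply_val)
open Literature.MathematicalPhysics.QuantumFieldTheory.Balaban1983to89.B5Ineq110P12Lattice (natAbs_valMinAbs_intCast_sub)
open Literature.MathematicalPhysics.QuantumFieldTheory.Balaban1983to89.LatticeNorms (supNorm supNorm_le norm_le_supNorm
  supNorm_nonneg)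

noncomputable section

variable {d : ℕ}

/-! ## §1 Periodised compactly supported profiles: a circular Lipschitz bound; products of numbers in `[0,1]` -/

section Profiles

/-- the data of a profile used at unit scale: values in `[0,1]`, Lipschitz constant `L ≥ 0`, vanishing for `|t| ≥ ⅞`
(satisfied by the printed `h` of (1.118) — which vanishes already for `|t| ≥ ⅝` — and by r01's plateau profile `θ`).
[cite: Balaban1984PropagatorsI, (1.118) p.36 («h ∈ C₀^∞(]−⅔, ⅔[)»)] -/
structure ProfileData (f : ℝ → ℝ) (L : ℝ) : Prop where
  nonneg : ∀ t, 0 ≤ f t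
  le_one : ∀ t, f t ≤ 1
  L_nonneg : 0 ≤ L
  lip : ∀ a b, |f a - f b| ≤ L * |a - b|
  zero_of : ∀ t, 7 / 8 ≤ |t| → f t = 0

/-- the printed profile `h` of (1.118) is such a profile, `L = sup|h′|`. [cite: Balaban1984PropagatorsI, (1.118) p.36] -/
theorem profileData_hprof : ProfileData hprof (D1 hprof) where
  nonneg := hprof_nonneg
  le_one := hprof_le_one
  L_nonneg := D1_nonneg contDiff_hprof hasCompactSupport_hprof
  lip := fun a b => by
    have h := abs_sub_le_D1 contDiff_hprof hasCompactSupport_hprof b a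
    exact h
  zero_of := fun t ht => hprof_eq_zero (by linarith)

/-- r01's plateau profile `θ` (`B4PartitionUnity22.thetaProf`) is such a profile, `L = sup|θ′|`.
[cite: Balaban1984PropagatorsI, Prop. 1.2 (1.111) p.35 («ζ ∈ C₀^∞(Δ̃(y))»)] -/
theorem profileData_thetaProf : ProfileData thetaProf (D1 thetaProf) where
  nonneg := thetaProf_nonneg
  le_one := thetaProf_le_one
  L_nonneg := D1_nonneg contDiff_thetaProf hasCompactSupport_thetaProf
  lip := fun a b => by
    have h := abs_sub_le_D1 contDiff_thetaProf hasCompactSupport_thetaProf b a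
    exact h
  zero_of := fun t ht => thetaProf_eq_zero ht

/-- the periodisation of a profile over the period `P`: `u ↦ f(crep_P u)` (for `f = h` this is `B5Partition118Printed.hper`).
[cite: Balaban1984PropagatorsI, (1.118) p.36] -/
def per (f : ℝ → ℝ) (P : ℕ) (u : ℝ) : ℝ := f (crep P u)

/-- `hper = per h`. [cite: Balaban1984PropagatorsI, (1.118) p.36] -/
theorem hper_eq_per (P : ℕ) (u : ℝ) : hper P u = per hprof P u := rfl

/-- periodicity of the periodisation. [cite: Balaban1984PropagatorsI, (1.118) p.36] -/
theorem per_add_int_mul (f : ℝ → ℝ) {P : ℕ} (hP : 1 ≤ P) (u : ℝ) (k : ℤ) : per f P (u + k * P) = per f P u := by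
  unfold per
  have hP0 : (P : ℝ) ≠ 0 := by
    have : (0 : ℝ) < P := by exact_mod_cast hP
    exact this.ne'
  rw [crep_add_int_mul hP0]

/-- values of a profile differ by at most `1`. [cite: Balaban1984PropagatorsI, (1.118) p.36] -/
theorem ProfileData.abs_sub_le_one {f : ℝ → ℝ} {L : ℝ} (hf : ProfileData f L) (a b : ℝ) : |f a - f b| ≤ 1 := by
  rw [abs_sub_le_iff]
  constructor
  · linarith [hf.le_one a, hf.nonneg b]
  · linarith [hf.le_one b, hf.nonneg a]

/-- **CIRCULAR LIPSCHITZ BOUND FOR A PERIODISED PROFILE** (period `P ≥ 2`): `|f(crep_P u) − f(crep_P v)| ≤ max(L, 8)·|crep_P(u − v)|`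
— pairs at circular distance `≥ ⅛` are paid by `1 ≤ 8·⅛`; closer pairs are moved into one chart `u, v + kP` where either both
centred representatives use the same integer (plain Lipschitz bound) or both values vanish (each argument has size
`≥ P/2 − ⅛ ≥ ⅞`). (plumbing of the printed torus partition) [cite: Balaban1984PropagatorsI, (1.118) p.36] -/
theorem per_lipschitz {f : ℝ → ℝ} {L : ℝ} (hf : ProfileData f L) {P : ℕ} (hP : 2 ≤ P) (u v : ℝ) :
    |per f P u - per f P v| ≤ max L 8 * |crep P (u - v)| := by
  have hP' : (2 : ℝ) ≤ P := by exact_mod_cast hP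
  have hP0 : (0 : ℝ) < P := by linarith
  have hK0 : 0 ≤ max L 8 := le_max_of_le_right (by norm_num)
  set δ : ℝ := |crep P (u - v)| with hδ
  have hδ0 : 0 ≤ δ := abs_nonneg _
  by_cases h8 : 1 / 8 ≤ δ
  · calc |per f P u - per f P v| ≤ 1 := hf.abs_sub_le_one _ _
      _ ≤ 8 * δ := by linarith
      _ ≤ max L 8 * δ := mul_le_mul_of_nonneg_right (le_max_right _ _) hδ0
  · have h8' : δ < 1 / 8 := not_le.mp h8
    -- move `v` into the chart of `u`
    set k : ℤ := round ((u - v) / P) with hk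
    set v' : ℝ := v + k * P with hv'
    have huv' : u - v' = crep P (u - v) := by rw [hv', crep_eq_sub]; ring
    have hper_v : per f P v' = per f P v := per_add_int_mul f (by omega) v k
    rw [← hper_v]
    have hclose : |u - v'| < 1 / 8 := by rw [huv']; exact h8'
    -- the two centred representatives
    set m : ℤ := round (u / P) with hm
    set m' : ℤ := round (v' / P) with hm'
    have hcu : crep P u = u - m * P := by rw [crep_eq_sub]
    have hcv : crep P v' = v' - m' * P := by rw [crep_eq_sub]
    unfold per
    by_cases hmm : m = m'
    · -- same chart: plain Lipschitz bound
      have hdiff : crep P u - crep P v' = u - v' := by rw [hcu, hcv, hmm]; ring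
      calc |f (crep P u) - f (crep P v')| ≤ L * |crep P u - crep P v'| := hf.lip _ _
        _ = L * δ := by rw [hdiff, huv']
        _ ≤ max L 8 * δ := mul_le_mul_of_nonneg_right (le_max_left _ _) hδ0
    · -- different charts: both values vanish
      have hgap : (P : ℝ) ≤ |(m : ℝ) * P - m' * P| := by
        rw [← sub_mul, abs_mul, abs_of_pos hP0, ← Int.cast_sub]
        have h1 : (1 : ℤ) ≤ |m - m'| := Int.one_le_abs (sub_ne_zero.mpr hmm)
        have h1' : (1 : ℝ) ≤ |((m - m' : ℤ) : ℝ)| := by rw [← Int.cast_abs]; exact_mod_cast h1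
        nlinarith
      have hbu : |crep P u| ≤ P / 2 := abs_crep_le hP0 u
      have hbv : |crep P v'| ≤ P / 2 := abs_crep_le hP0 v'
      -- |crep v'| ≥ 7/8
      have hv7 : 7 / 8 ≤ |crep P v'| := by
        have h1 : |v' - m * P| ≤ 1 / 8 + P / 2 := by
          calc |v' - m * P| = |(v' - u) + (u - m * P)| := by ring_nf
            _ ≤ |v' - u| + |u - m * P| := abs_add_le _ _
            _ ≤ 1 / 8 + P / 2 := by
                rw [abs_sub_comm, ← hcu]; exact add_le_add hclose.le hbu
        have h2 : |(m : ℝ) * P - m' * P| ≤ |v' - m' * P| + |v' - m * P| := by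
          calc |(m : ℝ) * P - m' * P| = |(v' - m' * P) - (v' - m * P)| := by ring_nf
            _ ≤ |v' - m' * P| + |v' - m * P| := abs_sub _ _
        rw [← hcv] at h2
        linarith
      -- |crep u| ≥ 7/8
      have hu7 : 7 / 8 ≤ |crep P u| := by
        have h1 : |u - m' * P| ≤ 1 / 8 + P / 2 := by
          calc |u - m' * P| = |(u - v') + (v' - m' * P)| := by ring_nf
            _ ≤ |u - v'| + |v' - m' * P| := abs_add_le _ _
            _ ≤ 1 / 8 + P / 2 := by rw [← hcv]; exact add_le_add hclose.le hbv
        have h2 : |(m : ℝ) * P - m' * P| ≤ |u - m * P| + |u - m' * P| := by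
          calc |(m : ℝ) * P - m' * P| = |(u - m' * P) - (u - m * P)| := by ring_nf
            _ ≤ |u - m' * P| + |u - m * P| := abs_sub _ _
            _ = |u - m * P| + |u - m' * P| := add_comm _ _
        rw [← hcu] at h2
        linarith
      rw [hf.zero_of _ hu7, hf.zero_of _ hv7, sub_zero, abs_zero]
      positivity

/-- subadditivity of the centred representative: `|crep_P(a + b)| ≤ |crep_P a| + |crep_P b|` (plumbing of the printed torus
partition, companion of `B5Partition118Printed.abs_crep_le_abs_sub`). [cite: Balaban1984PropagatorsI, (1.118) p.36] -/
theorem abs_crep_add_le {P : ℝ} (hP : 0 < P) (a b : ℝ) : |crep P (a + b)| ≤ |crep P a| + |crep P b| := by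
  have h := abs_crep_le_abs_sub hP (a + b) (round (a / P) + round (b / P))
  calc |crep P (a + b)| ≤ |a + b - ((round (a / P) + round (b / P) : ℤ) : ℝ) * P| := h
    _ = |crep P a + crep P b| := by rw [crep_eq_sub, crep_eq_sub]; push_cast; ring_nf
    _ ≤ |crep P a| + |crep P b| := abs_add_le _ _

/-- `|crep_P(−a)| = |crep_P a|` (plumbing of the printed torus partition). [cite: Balaban1984PropagatorsI, (1.118) p.36] -/
theorem abs_crep_neg {P : ℝ} (hP : 0 < P) (a : ℝ) : |crep P (-a)| = |crep P a| := by
  apply le_antisymm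
  · have h := abs_crep_le_abs_sub hP (-a) (-round (a / P))
    calc |crep P (-a)| ≤ |-a - ((-round (a / P) : ℤ) : ℝ) * P| := h
      _ = |crep P a| := by rw [crep_eq_sub]; push_cast; rw [← abs_neg]; ring_nf
  · have h := abs_crep_le_abs_sub hP a (-round (-a / P))
    calc |crep P a| ≤ |a - ((-round (-a / P) : ℤ) : ℝ) * P| := h
      _ = |crep P (-a)| := by rw [crep_eq_sub (u := -a)]; push_cast; rw [← abs_neg]; ring_nf

/-- `|crep_P a| ≤ |a|` (plumbing of the printed torus partition). [cite: Balaban1984PropagatorsI, (1.118) p.36] -/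
theorem abs_crep_le_abs {P : ℝ} (hP : 0 < P) (a : ℝ) : |crep P a| ≤ |a| := by
  have h := abs_crep_le_abs_sub hP a 0
  simpa using h

/-- **`|Π_i a_i − Π_i b_i| ≤ Σ_i |a_i − b_i|`** for numbers in `[0,1]` (the step behind the `O(M₀⁻¹)` size of the first differences of the product
`h_z(x) = Π_μ h((x_μ − z_μ)/M₀)` of (1.118); elementary). [cite: Balaban1984PropagatorsI, (1.118) p.36 with (1.121) p.37] -/
theorem abs_prod_sub_prod_le {ι : Type*} (s : Finset ι) (a b : ι → ℝ) (ha0 : ∀ i ∈ s, 0 ≤ a i) (ha1 : ∀ i ∈ s, a i ≤ 1)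
    (hb0 : ∀ i ∈ s, 0 ≤ b i) (hb1 : ∀ i ∈ s, b i ≤ 1) :
    |∏ i ∈ s, a i - ∏ i ∈ s, b i| ≤ ∑ i ∈ s, |a i - b i| := by
  classical
  induction s using Finset.induction_on with
  | empty => simp
  | insert j s hj ih =>
      have ha0' : ∀ i ∈ s, 0 ≤ a i := fun i hi => ha0 i (Finset.mem_insert_of_mem hi)
      have ha1' : ∀ i ∈ s, a i ≤ 1 := fun i hi => ha1 i (Finset.mem_insert_of_mem hi)
      have hb0' : ∀ i ∈ s, 0 ≤ b i := fun i hi => hb0 i (Finset.mem_insert_of_mem hi)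
      have hb1' : ∀ i ∈ s, b i ≤ 1 := fun i hi => hb1 i (Finset.mem_insert_of_mem hi)
      have ih' := ih ha0' ha1' hb0' hb1'
      rw [Finset.prod_insert hj, Finset.prod_insert hj, Finset.sum_insert hj]
      have hPa : 0 ≤ ∏ i ∈ s, a i := Finset.prod_nonneg ha0'
      have hPb : 0 ≤ ∏ i ∈ s, b i := Finset.prod_nonneg hb0'
      have hPb1 : ∏ i ∈ s, b i ≤ 1 := Finset.prod_le_one hb0' hb1'
      have haj0 := ha0 j (Finset.mem_insert_self j s)
      have haj1 := ha1 j (Finset.mem_insert_self j s)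
      calc |a j * ∏ i ∈ s, a i - b j * ∏ i ∈ s, b i|
          = |a j * (∏ i ∈ s, a i - ∏ i ∈ s, b i) + (a j - b j) * ∏ i ∈ s, b i| := by ring_nf
        _ ≤ |a j * (∏ i ∈ s, a i - ∏ i ∈ s, b i)| + |(a j - b j) * ∏ i ∈ s, b i| := abs_add_le _ _
        _ = a j * |∏ i ∈ s, a i - ∏ i ∈ s, b i| + |a j - b j| * ∏ i ∈ s, b i := by
            rw [abs_mul, abs_mul, abs_of_nonneg haj0, abs_of_nonneg hPb]
        _ ≤ 1 * (∑ i ∈ s, |a i - b i|) + |a j - b j| * 1 := by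
            gcongr
        _ = |a j - b j| + ∑ i ∈ s, |a i - b i| := by ring

end Profiles

/-! ## §2 Unit coordinates on the fine torus and the circular-distance dictionary -/

section Coordinates

variable (M : Fin d → ℕ) [hM : ∀ μ, NeZero (M μ)] (n : ℕ) [NeZero n]

/-- the unit coordinate `x_μ/n ∈ [0, M_μ)` of a fine site (`η = 1/n`; representative `val`).
[cite: Balaban1984PropagatorsI, p.35 (the lattice T_η and its unit lattice T₁^{(k)})] -/
def uc (x : Tor (fine n M)) (μ : Fin d) : ℝ := ((x μ).val : ℝ) / n

/-- **the dictionary**: the fine circular coordinate distance `cdistF x x′ μ` (in fine steps) is `n·|crep_{M_μ}(x_μ/n − x′_μ/n)|`.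
[cite: Balaban1984PropagatorsI, (1.109) p.35 (|x − x′|)] -/
theorem cdistF_eq_mul_abs_crep (hn : 1 ≤ n) (x x' : Tor (fine n M)) (μ : Fin d) :
    ((cdistF n M x x' μ : ℕ) : ℝ) = (n : ℝ) * |crep (M μ) (uc M n x μ - uc M n x' μ)| := by
  have hz : ((cdistF n M x x' μ : ℕ) : ℤ)
      = circAbs (n * M μ) ((((x μ).val : ℕ) : ℤ) - (((x' μ).val : ℕ) : ℤ)) := by
    have h := natAbs_valMinAbs_intCast_sub (N := fine n M μ) (((x μ).val : ℕ) : ℤ) (((x' μ).val : ℕ) : ℤ)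
    simp only [Int.cast_natCast, ZMod.natCast_zmod_val] at h
    unfold cdistF
    exact h
  have hzR : ((cdistF n M x x' μ : ℕ) : ℝ)
      = ((circAbs (n * M μ) ((((x μ).val : ℕ) : ℤ) - (((x' μ).val : ℕ) : ℤ)) : ℤ) : ℝ) := by exact_mod_cast hz
  have hc := natMul_abs_crep_eq_circAbs hn (one_le_M M μ) ((((x μ).val : ℕ) : ℤ) - (((x' μ).val : ℕ) : ℤ))
  have e : (((((x μ).val : ℕ) : ℤ) - (((x' μ).val : ℕ) : ℤ) : ℤ) : ℝ) / (n : ℝ) = uc M n x μ - uc M n x' μ := by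
    unfold uc; push_cast; ring
  rw [hzR, ← hc, e]

omit hM in
/-- `cdistF x x′ μ ≤ n·distU x x′`. [cite: Balaban1984PropagatorsI, (1.109) p.35 (|x − x′|)] -/
theorem cdistF_le_mul_distU (x x' : Tor (fine n M)) (μ : Fin d) :
    ((cdistF n M x x' μ : ℕ) : ℝ) ≤ (n : ℝ) * distU n M x x' := by
  unfold distU
  have hn0 : (0 : ℝ) < n := by exact_mod_cast Nat.pos_of_ne_zero (NeZero.ne n)
  rw [mul_div_cancel₀ _ hn0.ne']
  exact_mod_cast Finset.le_sup (f := cdistF n M x x') (Finset.mem_univ μ)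

/-- **`|crep_{M_μ}(x_μ/n − x′_μ/n)| ≤ distU x x′`** for every coordinate. [cite: Balaban1984PropagatorsI, (1.109) p.35 (|x − x′|)] -/
theorem abs_crep_uc_sub_le_distU (hn : 1 ≤ n) (x x' : Tor (fine n M)) (μ : Fin d) :
    |crep (M μ) (uc M n x μ - uc M n x' μ)| ≤ distU n M x x' := by
  have hn0 : (0 : ℝ) < n := by exact_mod_cast hn
  have h1 := cdistF_eq_mul_abs_crep M n hn x x' μ
  have h2 := cdistF_le_mul_distU M n x x' μ
  rw [h1] at h2
  exact le_of_mul_le_mul_left h2 hn0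

/-- the dictionary for a unit-lattice point: `cdistF x (n·y) μ = n·|crep_{M_μ}(x_μ/n − y_μ)|`.
[cite: Balaban1984PropagatorsI, p.35 (the cubes Δ̃(y))] -/
theorem cdistF_toFine_eq (hn : 1 ≤ n) (x : Tor (fine n M)) (y : Tor M) (μ : Fin d) :
    ((cdistF n M x (toFine n M y) μ : ℕ) : ℝ) = (n : ℝ) * |crep (M μ) (uc M n x μ - ((y μ).val : ℝ))| := by
  have hz : ((cdistF n M x (toFine n M y) μ : ℕ) : ℤ)
      = circAbs (n * M μ) ((((x μ).val : ℕ) : ℤ) - ((n * (y μ).val : ℕ) : ℤ)) := by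
    have h := natAbs_valMinAbs_intCast_sub (N := fine n M μ) (((x μ).val : ℕ) : ℤ) ((n * (y μ).val : ℕ) : ℤ)
    rw [show ((((x μ).val : ℕ) : ℤ) : ZMod (fine n M μ)) = x μ by rw [Int.cast_natCast, ZMod.natCast_zmod_val]] at h
    unfold cdistF toFine
    exact h
  have hzR : ((cdistF n M x (toFine n M y) μ : ℕ) : ℝ)
      = ((circAbs (n * M μ) ((((x μ).val : ℕ) : ℤ) - ((n * (y μ).val : ℕ) : ℤ)) : ℤ) : ℝ) := by exact_mod_cast hz
  have hc := natMul_abs_crep_eq_circAbs hn (one_le_M M μ) ((((x μ).val : ℕ) : ℤ) - ((n * (y μ).val : ℕ) : ℤ))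
  have hn0 : (n : ℝ) ≠ 0 := by
    have : (0 : ℝ) < n := by exact_mod_cast hn
    exact this.ne'
  have e : (((((x μ).val : ℕ) : ℤ) - ((n * (y μ).val : ℕ) : ℤ) : ℤ) : ℝ) / (n : ℝ) = uc M n x μ - ((y μ).val : ℝ) := by
    unfold uc; push_cast; field_simp
  rw [hzR, ← hc, e]

/-- **`x ∈ Δ̃(y) ↔ ∀ μ, |crep_{M_μ}(x_μ/n − y_μ)| ≤ 1`** — the doubled cube in unit coordinates.
[cite: Balaban1984PropagatorsI, p.35 («cubes of size 2 and with a center at y»)] -/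
theorem mem_cubeT_iff_crep (hn : 1 ≤ n) (x : Tor (fine n M)) (y : Tor M) :
    x ∈ cubeT n M y ↔ ∀ μ, |crep (M μ) (uc M n x μ - ((y μ).val : ℝ))| ≤ 1 := by
  have hn0 : (0 : ℝ) < n := by exact_mod_cast hn
  rw [cubeT, Finset.mem_filter]
  simp only [Finset.mem_univ, true_and]
  refine forall_congr' fun μ => ?_
  have h := cdistF_toFine_eq M n hn x y μ
  constructor
  · intro hle
    have hle' : ((cdistF n M x (toFine n M y) μ : ℕ) : ℝ) ≤ n := by exact_mod_cast hle
    rw [h] at hle'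
    nlinarith
  · intro hle
    have : ((cdistF n M x (toFine n M y) μ : ℕ) : ℝ) ≤ n := by rw [h]; nlinarith
    exact_mod_cast this

omit hM [NeZero n] in
/-- `distU` is symmetric. [cite: Balaban1984PropagatorsI, (1.109) p.35 (|x − x′|)] -/
theorem distU_comm (x x' : Tor (fine n M)) : distU n M x x' = distU n M x' x := by
  unfold distU
  have : cdistF n M x x' = cdistF n M x' x := by
    funext μ
    unfold cdistF
    rw [← neg_sub, ZMod.natAbs_valMinAbs_neg]
  rw [this]

omit hM [NeZero n] in
/-- `0 ≤ x_μ/n`. [cite: Balaban1984PropagatorsI, p.35 (T_η)] -/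
theorem uc_nonneg (x : Tor (fine n M)) (μ : Fin d) : 0 ≤ uc M n x μ := by
  unfold uc; positivity

end Coordinates

/-! ## §3 The piece weights: the printed profile of (1.118) at unit scale, squared -/

section Pieces

variable (M : Fin d → ℕ) [hM : ∀ μ, NeZero (M μ)] (n : ℕ) [NeZero n]

/-- the lifted fine coordinates `(x_μ)_μ ∈ ℝ^d` (in fine steps). [cite: Balaban1984PropagatorsI, p.35 (T_η)] -/
def liftF (x : Tor (fine n M)) : Fin d → ℝ := fun μ => ((x μ).val : ℝ)

/-- **THE PIECE WEIGHTS `wP y′ x = h_{y′}(x)²`**: the printed partition function of (1.118) `h_{y′}(x) = Π_μ h((x_μ − y′_μ)/M₀)`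
at the unit scale `M₀ := 1` unit `= n` fine steps, centred at the unit-lattice point `y′ ∈ T₁` (`B5Partition118Printed.hzR` with
cube scale `n` and centre torus `T₁ = Π_μ ℤ/M_μ`), SQUARED so that `Σ_{y′} wP y′ = 1` by (1.118).
[cite: Balaban1984PropagatorsI, (1.118) p.36, (1.115)–(1.117) p.36] -/
def wP (y' : Tor M) (x : Tor (fine n M)) : ℝ := hzR M (n : ℝ) (chartSite M y') (liftF M n x) ^ 2

omit [NeZero n] in
/-- unfolding: `wP y′ x = (Π_μ hper_{M_μ}(x_μ/n − y′_μ))²`. [cite: Balaban1984PropagatorsI, (1.118) p.36] -/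
theorem wP_eq (y' : Tor M) (x : Tor (fine n M)) :
    wP M n y' x = (∏ μ, hper (M μ) (uc M n x μ - ((y' μ).val : ℝ))) ^ 2 := by
  unfold wP hzR liftF uc
  rfl

omit [NeZero n] in
/-- `0 ≤ wP`. [cite: Balaban1984PropagatorsI, (1.118) p.36] -/
theorem wP_nonneg (y' : Tor M) (x : Tor (fine n M)) : 0 ≤ wP M n y' x := sq_nonneg _

omit [NeZero n] in
/-- `wP ≤ 1`. [cite: Balaban1984PropagatorsI, (1.118) p.36] -/
theorem wP_le_one (y' : Tor M) (x : Tor (fine n M)) : wP M n y' x ≤ 1 := by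
  unfold wP
  have h0 := hzR_nonneg M (n : ℝ) (chartSite M y') (liftF M n x)
  have h1 := hzR_le_one M (n : ℝ) (chartSite M y') (liftF M n x)
  nlinarith

/-- the coordinate map `T₁ → Π_μ Fin (M μ)` is a bijection. [cite: Balaban1984PropagatorsI, p.35 (T₁^{(k)})] -/
theorem chartSite_bijective : Function.Bijective (chartSite M) := by
  rw [Fintype.bijective_iff_injective_and_card]
  refine ⟨chartSite_injective M, ?_⟩
  simp [Tor, TSite, Fintype.card_pi, ZMod.card]

omit [NeZero n] in
/-- **`Σ_{y′∈T₁} wP y′ x = 1`** (the printed (1.118) `Σ_z h_z² = 1` at unit scale), on every torus with at least two unit cubes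
in every direction. [cite: Balaban1984PropagatorsI, (1.118) p.36 («Σ_z h_z²(x) = 1»)] -/
theorem sum_wP (hM2 : ∀ μ, 2 ≤ M μ) (x : Tor (fine n M)) : ∑ y' : Tor M, wP M n y' x = 1 := by
  unfold wP
  rw [Fintype.sum_bijective (chartSite M) (chartSite_bijective M)
    (fun y' => hzR M (n : ℝ) (chartSite M y') (liftF M n x) ^ 2) (fun z => hzR M (n : ℝ) z (liftF M n x) ^ 2)
    (fun _ => rfl)]
  exact sum_hzR_sq hM2 (n : ℝ) (liftF M n x)

/-- **support: `wP y′ x ≠ 0 ⇒ x ∈ Δ̃(y′)`** (each factor `h` vanishes for `|t| ≥ ⅔ < 1`).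
[cite: Balaban1984PropagatorsI, (1.118) p.36 («h ∈ C₀^∞(]−⅔, ⅔[)»), p.35 (Δ̃(y))] -/
theorem mem_cubeT_of_wP_ne_zero (hn : 1 ≤ n) {y' : Tor M} {x : Tor (fine n M)} (h : wP M n y' x ≠ 0) :
    x ∈ cubeT n M y' := by
  rw [mem_cubeT_iff_crep M n hn]
  intro μ
  rw [wP_eq] at h
  have h' : ∏ μ, hper (M μ) (uc M n x μ - ((y' μ).val : ℝ)) ≠ 0 := fun h0 => h (by rw [h0]; ring)
  have hμ := (Finset.prod_ne_zero_iff.mp h') μ (Finset.mem_univ μ)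
  by_contra hcon
  have hcon' : 2 / 3 ≤ |crep (M μ) (uc M n x μ - ((y' μ).val : ℝ))| := by linarith [not_le.mp hcon]
  exact hμ (hper_eq_zero hcon')

/-- the support in the carrier's words: `suppInL`-type statement for the scalar weight. [cite: Balaban1984PropagatorsI, (1.115)–(1.117) p.36] -/
theorem wP_eq_zero_of_not_mem (hn : 1 ≤ n) {y' : Tor M} {x : Tor (fine n M)} (h : x ∉ cubeT n M y') :
    wP M n y' x = 0 := by
  by_contra hne
  exact h (mem_cubeT_of_wP_ne_zero M n hn hne)

/-- **THE UNIT-SCALE LIPSCHITZ CONSTANT OF THE PIECE WEIGHTS**: `Lw(d) = 2d·max(sup|h′|, 8)` (ours).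
[cite: Balaban1984PropagatorsI, (1.118) p.36, (1.109) p.35] -/
def Lw (d : ℕ) : ℝ := 2 * d * max (D1 hprof) 8

/-- `0 ≤ Lw`. [cite: Balaban1984PropagatorsI, (1.118) p.36] -/
theorem Lw_nonneg (d : ℕ) : 0 ≤ Lw d := by
  unfold Lw
  have : (0 : ℝ) ≤ max (D1 hprof) 8 := le_max_of_le_right (by norm_num)
  positivity

/-- **LIPSCHITZ BOUND OF THE PIECE WEIGHTS AT UNIT SCALE, UNIFORM IN `η` AND IN THE TORUS**:
`|wP y′ x − wP y′ x′| ≤ Lw(d)·distU x x′` (tori with `≥ 2` unit cubes per direction).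
[cite: Balaban1984PropagatorsI, (1.118) p.36, (1.109) p.35 (|x − x′|)] -/
theorem abs_wP_sub_le (hn : 1 ≤ n) (hM2 : ∀ μ, 2 ≤ M μ) (y' : Tor M) (x x' : Tor (fine n M)) :
    |wP M n y' x - wP M n y' x'| ≤ Lw d * distU n M x x' := by
  rw [wP_eq, wP_eq]
  set a : Fin d → ℝ := fun μ => hper (M μ) (uc M n x μ - ((y' μ).val : ℝ)) with ha
  set b : Fin d → ℝ := fun μ => hper (M μ) (uc M n x' μ - ((y' μ).val : ℝ)) with hb
  have ha0 : ∀ μ, 0 ≤ a μ := fun μ => hprof_nonneg _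
  have ha1 : ∀ μ, a μ ≤ 1 := fun μ => hprof_le_one _
  have hb0 : ∀ μ, 0 ≤ b μ := fun μ => hprof_nonneg _
  have hb1 : ∀ μ, b μ ≤ 1 := fun μ => hprof_le_one _
  have hPa0 : 0 ≤ ∏ μ, a μ := Finset.prod_nonneg fun μ _ => ha0 μ
  have hPa1 : ∏ μ, a μ ≤ 1 := Finset.prod_le_one (fun μ _ => ha0 μ) fun μ _ => ha1 μ
  have hPb0 : 0 ≤ ∏ μ, b μ := Finset.prod_nonneg fun μ _ => hb0 μ
  have hPb1 : ∏ μ, b μ ≤ 1 := Finset.prod_le_one (fun μ _ => hb0 μ) fun μ _ => hb1 μ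
  -- each factor: circular Lipschitz
  have hfac : ∀ μ, |a μ - b μ| ≤ max (D1 hprof) 8 * distU n M x x' := by
    intro μ
    have h := per_lipschitz profileData_hprof (hM2 μ) (uc M n x μ - ((y' μ).val : ℝ)) (uc M n x' μ - ((y' μ).val : ℝ))
    have e : uc M n x μ - ((y' μ).val : ℝ) - (uc M n x' μ - ((y' μ).val : ℝ)) = uc M n x μ - uc M n x' μ := by ring
    rw [e] at h
    have hK0 : 0 ≤ max (D1 hprof) 8 := le_max_of_le_right (by norm_num)
    calc |a μ - b μ| = |per hprof (M μ) (uc M n x μ - ((y' μ).val : ℝ)) - per hprof (M μ) (uc M n x' μ - ((y' μ).val : ℝ))| := rfl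
      _ ≤ max (D1 hprof) 8 * |crep (M μ) (uc M n x μ - uc M n x' μ)| := h
      _ ≤ max (D1 hprof) 8 * distU n M x x' := mul_le_mul_of_nonneg_left (abs_crep_uc_sub_le_distU M n hn x x' μ) hK0
  have hprod : |∏ μ, a μ - ∏ μ, b μ| ≤ d * (max (D1 hprof) 8 * distU n M x x') := by
    calc |∏ μ, a μ - ∏ μ, b μ| ≤ ∑ μ, |a μ - b μ| :=
          abs_prod_sub_prod_le Finset.univ a b (fun μ _ => ha0 μ) (fun μ _ => ha1 μ) (fun μ _ => hb0 μ) fun μ _ => hb1 μ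
      _ ≤ ∑ _μ : Fin d, max (D1 hprof) 8 * distU n M x x' := Finset.sum_le_sum fun μ _ => hfac μ
      _ = d * (max (D1 hprof) 8 * distU n M x x') := by rw [Finset.sum_const, Finset.card_univ, Fintype.card_fin]; ring
  -- squares: |A² − B²| = |A − B|·|A + B| ≤ 2|A − B|
  calc |(∏ μ, a μ) ^ 2 - (∏ μ, b μ) ^ 2| = |∏ μ, a μ - ∏ μ, b μ| * |∏ μ, a μ + ∏ μ, b μ| := by
        rw [sq_sub_sq, abs_mul, mul_comm]
    _ ≤ (d * (max (D1 hprof) 8 * distU n M x x')) * 2 := by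
        refine mul_le_mul hprod ?_ (abs_nonneg _) (by
          have : (0 : ℝ) ≤ max (D1 hprof) 8 := le_max_of_le_right (by norm_num)
          have := distU_nonneg (n := n) (M := M) x x'
          positivity)
        rw [abs_of_nonneg (by positivity)]
        linarith
    _ = Lw d * distU n M x x' := by unfold Lw; ring

end Pieces

/-! ## §4 The plateau cut-offs `ζ_y ∈ C₀^∞(Δ̃(y))` -/

section Cuts

variable (M : Fin d → ℕ) [hM : ∀ μ, NeZero (M μ)] (n : ℕ) [NeZero n]

/-- **THE PLATEAU CUT-OFF OF THE DOUBLED CUBE `Δ̃(y)`**: `cutP y x = Π_μ θ(crep_{M_μ}(x_μ/n − y_μ))` with r01's C^∞ plateau profile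
`θ` (`= 1` on `|t| ≤ ¾`, `= 0` for `|t| ≥ ⅞`, values in `[0,1]`) — a lattice reading of «ζ ∈ C₀^∞(Δ̃(y))» equal to `1` on the cube
of side `3/2` centred at `y`. [cite: Balaban1984PropagatorsI, Prop. 1.2 (1.111) p.35 («ζ ∈ C₀^∞(Δ̃(y))»), (1.115)–(1.117) p.36] -/
def cutP (y : Tor M) (x : Tor (fine n M)) : ℝ := ∏ μ, per thetaProf (M μ) (uc M n x μ - ((y μ).val : ℝ))

omit hM [NeZero n] in
/-- `0 ≤ cutP`. [cite: Balaban1984PropagatorsI, Prop. 1.2 (1.111) p.35] -/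
theorem cutP_nonneg (y : Tor M) (x : Tor (fine n M)) : 0 ≤ cutP M n y x :=
  Finset.prod_nonneg fun _ _ => thetaProf_nonneg _

omit hM [NeZero n] in
/-- `cutP ≤ 1`. [cite: Balaban1984PropagatorsI, Prop. 1.2 (1.111) p.35] -/
theorem cutP_le_one (y : Tor M) (x : Tor (fine n M)) : cutP M n y x ≤ 1 :=
  Finset.prod_le_one (fun _ _ => thetaProf_nonneg _) fun _ _ => thetaProf_le_one _

/-- **support: `cutP y x ≠ 0 ⇒ x ∈ Δ̃(y)`**, i.e. `cutInL (cutP y) y`. [cite: Balaban1984PropagatorsI, Prop. 1.2 (1.111) p.35 («ζ ∈ C₀^∞(Δ̃(y))»)] -/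
theorem cutInL_cutP (hn : 1 ≤ n) (y : Tor M) : cutInL n M (cutP M n y) y := by
  intro x hx
  rw [mem_cubeT_iff_crep M n hn]
  intro μ
  have hμ := (Finset.prod_ne_zero_iff.mp hx) μ (Finset.mem_univ μ)
  by_contra hcon
  have hcon' : 7 / 8 ≤ |crep (M μ) (uc M n x μ - ((y μ).val : ℝ))| := by linarith [not_le.mp hcon]
  exact hμ (thetaProf_eq_zero hcon')

omit hM [NeZero n] in
/-- **plateau: `cutP y x = 1` whenever `|crep_{M_μ}(x_μ/n − y_μ)| ≤ ¾` for all `μ`**.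
[cite: Balaban1984PropagatorsI, Prop. 1.2 (1.111) p.35] -/
theorem cutP_eq_one_of {y : Tor M} {x : Tor (fine n M)} (h : ∀ μ, |crep (M μ) (uc M n x μ - ((y μ).val : ℝ))| ≤ 3 / 4) :
    cutP M n y x = 1 :=
  Finset.prod_eq_one fun μ _ => thetaProf_eq_one (h μ)

/-- `|cutP| ≤ 1`: `cutSupL (cutP y) ≤ 1`. [cite: Balaban1984PropagatorsI, Prop. 1.2 (1.111) p.35 (|ζ|)] -/
theorem cutSupL_cutP_le_one (y : Tor M) : cutSupL n M (cutP M n y) ≤ 1 :=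
  supNorm_le zero_le_one fun x _ => by
    rw [Real.norm_eq_abs, abs_of_nonneg (cutP_nonneg M n y x)]
    exact cutP_le_one M n y x

/-- **THE UNIT-SCALE LIPSCHITZ CONSTANT OF THE CUT-OFFS**: `Lθ(d) = d·max(sup|θ′|, 8)` (ours).
[cite: Balaban1984PropagatorsI, Prop. 1.2 (1.111) p.35 (‖ζ‖_α)] -/
def Lθ (d : ℕ) : ℝ := d * max (D1 thetaProf) 8

/-- `0 ≤ Lθ`. [cite: Balaban1984PropagatorsI, Prop. 1.2 (1.111) p.35] -/
theorem Lθ_nonneg (d : ℕ) : 0 ≤ Lθ d := by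
  unfold Lθ
  have : (0 : ℝ) ≤ max (D1 thetaProf) 8 := le_max_of_le_right (by norm_num)
  positivity

/-- **LIPSCHITZ BOUND OF THE CUT-OFFS AT UNIT SCALE, UNIFORM IN `η` AND IN THE TORUS**: `|cutP y x − cutP y x′| ≤ Lθ(d)·distU x x′`
(tori with `≥ 2` unit cubes per direction). [cite: Balaban1984PropagatorsI, Prop. 1.2 (1.111) p.35 (‖ζ‖_α + |ζ|), (1.109) p.35] -/
theorem abs_cutP_sub_le (hn : 1 ≤ n) (hM2 : ∀ μ, 2 ≤ M μ) (y : Tor M) (x x' : Tor (fine n M)) :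
    |cutP M n y x - cutP M n y x'| ≤ Lθ d * distU n M x x' := by
  unfold cutP
  set a : Fin d → ℝ := fun μ => per thetaProf (M μ) (uc M n x μ - ((y μ).val : ℝ)) with ha
  set b : Fin d → ℝ := fun μ => per thetaProf (M μ) (uc M n x' μ - ((y μ).val : ℝ)) with hb
  have hK0 : 0 ≤ max (D1 thetaProf) 8 := le_max_of_le_right (by norm_num)
  have hfac : ∀ μ, |a μ - b μ| ≤ max (D1 thetaProf) 8 * distU n M x x' := by
    intro μ
    have h := per_lipschitz profileData_thetaProf (hM2 μ) (uc M n x μ - ((y μ).val : ℝ)) (uc M n x' μ - ((y μ).val : ℝ))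
    have e : uc M n x μ - ((y μ).val : ℝ) - (uc M n x' μ - ((y μ).val : ℝ)) = uc M n x μ - uc M n x' μ := by ring
    rw [e] at h
    exact h.trans (mul_le_mul_of_nonneg_left (abs_crep_uc_sub_le_distU M n hn x x' μ) hK0)
  calc |∏ μ, a μ - ∏ μ, b μ| ≤ ∑ μ, |a μ - b μ| :=
        abs_prod_sub_prod_le Finset.univ a b (fun μ _ => thetaProf_nonneg _) (fun μ _ => thetaProf_le_one _)
          (fun μ _ => thetaProf_nonneg _) fun μ _ => thetaProf_le_one _
    _ ≤ ∑ _μ : Fin d, max (D1 thetaProf) 8 * distU n M x x' := Finset.sum_le_sum fun μ _ => hfac μ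
    _ = Lθ d * distU n M x x' := by rw [Finset.sum_const, Finset.card_univ, Fintype.card_fin]; unfold Lθ; ring

end Cuts

/-! ## §5 The nearest unit-lattice point and the plateau lemma -/

section Near

variable (M : Fin d → ℕ) [hM : ∀ μ, NeZero (M μ)] (n : ℕ) [NeZero n]

/-- **the nearest unit-lattice point** of a fine site: `nearOf x = (round(x_μ/n) mod M_μ)_μ ∈ T₁`.
[cite: Balaban1984PropagatorsI, p.35 (T₁^{(k)} and its cubes)] -/
def nearOf (x : Tor (fine n M)) : Tor M := fun μ => ((round (uc M n x μ) : ℤ) : ZMod (M μ))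

omit [NeZero n] in
/-- the representative of `nearOf x` differs from `round(x_μ/n)` by a multiple of the period (plumbing).
[cite: Balaban1984PropagatorsI, p.35 (T₁^{(k)})] -/
theorem exists_nearOf_val_eq (x : Tor (fine n M)) (μ : Fin d) :
    ∃ k : ℤ, ((nearOf M n x μ).val : ℝ) = (round (uc M n x μ) : ℝ) + k * (M μ : ℝ) := by
  refine ⟨-(round (uc M n x μ) / (M μ : ℤ)), ?_⟩
  have h : (((nearOf M n x μ).val : ℕ) : ℤ) = round (uc M n x μ) % (M μ : ℤ) := by
    unfold nearOf
    exact ZMod.val_intCast _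
  have h2 := Int.emod_add_ediv_mul (round (uc M n x μ)) (M μ : ℤ)
  have h3 : (((nearOf M n x μ).val : ℕ) : ℤ) = round (uc M n x μ) + -(round (uc M n x μ) / (M μ : ℤ)) * (M μ : ℤ) := by
    rw [h]; linarith
  have h4 := congrArg (fun z : ℤ => (z : ℝ)) h3
  push_cast at h4 ⊢
  linarith

omit [NeZero n] in
/-- **`|crep_{M_μ}(x_μ/n − nearOf_μ)| ≤ ½`** — the site lies in the half-unit cube around its nearest unit-lattice point.
[cite: Balaban1984PropagatorsI, p.35 (T₁^{(k)})] -/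
theorem abs_crep_uc_sub_nearOf_le (x : Tor (fine n M)) (μ : Fin d) :
    |crep (M μ) (uc M n x μ - ((nearOf M n x μ).val : ℝ))| ≤ 1 / 2 := by
  obtain ⟨k, hk⟩ := exists_nearOf_val_eq M n x μ
  have hM0 : (0 : ℝ) < (M μ : ℝ) := by exact_mod_cast Nat.pos_of_ne_zero (NeZero.ne (M μ))
  have hM1 : (M μ : ℝ) ≠ 0 := hM0.ne'
  rw [hk, show uc M n x μ - ((round (uc M n x μ) : ℝ) + k * (M μ : ℝ))
      = (uc M n x μ - round (uc M n x μ)) + (-k) * (M μ : ℝ) by ring]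
  have hper : crep (M μ : ℝ) ((uc M n x μ - round (uc M n x μ)) + ((-k : ℤ) : ℝ) * (M μ : ℝ))
      = crep (M μ : ℝ) (uc M n x μ - round (uc M n x μ)) := crep_add_int_mul hM1 _ _
  push_cast at hper
  rw [hper]
  exact (abs_crep_le_abs hM0 _).trans (abs_sub_round _)

/-- **every fine site lies in the doubled cube of its nearest unit-lattice point**: `x ∈ Δ̃(nearOf x)` (so the cubes Δ̃(y),
y ∈ T₁, cover T_η; print says «These cubes cover the lattice» of the M₀-cubes □_z, p. 36 L29 — v1.0 cited that sentence here).
[cite: Balaban1984PropagatorsI, p. 35 L27–29 («Cubes Δ̃(y) are sums of 2^d unit cubes having the point y as a corner,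
thus they are cubes of size 2 and with a center at y.»)] -/
theorem mem_cubeT_nearOf (hn : 1 ≤ n) (x : Tor (fine n M)) : x ∈ cubeT n M (nearOf M n x) := by
  rw [mem_cubeT_iff_crep M n hn]
  intro μ
  linarith [abs_crep_uc_sub_nearOf_le M n x μ]

/-- hence every bond index `(x, μ)` lies in `cubeB (nearOf x)`. [cite: Balaban1984PropagatorsI, p.35] -/
theorem mem_cubeB_nearOf (hn : 1 ≤ n) (b : Tor (fine n M) × Fin d) : b ∈ cubeB n M (nearOf M n b.1) :=
  Finset.mem_product.mpr ⟨mem_cubeT_nearOf M n hn b.1, Finset.mem_univ _⟩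

/-- **THE PLATEAU LEMMA**: a site `x′` within `¼` unit of `x` lies in the plateau of the cut-off of `nearOf x`:
`distU x x′ ≤ ¼ ⇒ cutP (nearOf x) x′ = 1`. [cite: Balaban1984PropagatorsI, Prop. 1.2 (1.111) p.35, (1.115)–(1.117) p.36 (‖∇GJ‖_α, ‖G∇*J‖_α global)] -/
theorem cutP_nearOf_eq_one_of_distU_le (hn : 1 ≤ n) {x x' : Tor (fine n M)} (h : distU n M x x' ≤ 1 / 4) :
    cutP M n (nearOf M n x) x' = 1 := by
  apply cutP_eq_one_of
  intro μ
  have hM0 : (0 : ℝ) < (M μ : ℝ) := by exact_mod_cast Nat.pos_of_ne_zero (NeZero.ne (M μ))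
  have h1 := abs_crep_uc_sub_nearOf_le M n x μ
  have h2 : |crep (M μ) (uc M n x' μ - uc M n x μ)| ≤ 1 / 4 := by
    have := abs_crep_uc_sub_le_distU M n hn x' x μ
    rw [distU_comm] at this
    exact this.trans h
  calc |crep (M μ) (uc M n x' μ - ((nearOf M n x μ).val : ℝ))|
      = |crep (M μ) ((uc M n x' μ - uc M n x μ) + (uc M n x μ - ((nearOf M n x μ).val : ℝ)))| := by ring_nf
    _ ≤ |crep (M μ) (uc M n x' μ - uc M n x μ)| + |crep (M μ) (uc M n x μ - ((nearOf M n x μ).val : ℝ))| :=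
        abs_crep_add_le hM0 _ _
    _ ≤ 1 / 4 + 1 / 2 := add_le_add h2 h1
    _ = 3 / 4 := by norm_num

/-- in particular `cutP (nearOf x) x = 1`. [cite: Balaban1984PropagatorsI, Prop. 1.2 (1.111) p.35] -/
theorem cutP_nearOf_eq_one (hn : 1 ≤ n) (x : Tor (fine n M)) : cutP M n (nearOf M n x) x = 1 :=
  cutP_nearOf_eq_one_of_distU_le M n hn (by rw [distU_self]; norm_num)

end Near

end

end Literature.MathematicalPhysics.QuantumFieldTheory.Balaban1983to89.B5CoverP12Lattice
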